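import Mathlib.Analysis.ODE.Gronwall
import Mathlib.Analysis.InnerProductSpace.Calculus
import Mathlib.Analysis.Calculus.Deriv.Slope
import Mathlib.Analysis.Calculus.Deriv.Mul
import Literature.Analysis.FunctionSpaces.TorusCalculusProofs
import HarnessLib

/-!
# The `L²` energy identity, Grönwall bound and uniqueness for linear symmetric hyperbolic systems
# on the flat torus (topic `Analysis/PDE`)

Analysis/PDE support file (everything proved; no definitions, no named facts), the flat-torus
twin of the order-zero layer of `SymmetricHyperbolicEnergy.lean` (whole space, `A⁰ = I`). It is
the first brick of the EXISTENCE MECHANISM of the classical local theory of quasilinear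
symmetrisable hyperbolic systems on `𝕋^d` (Dafermos 2005, Thm 5.1.1, proof: the linearised
iteration (5.1.10) is run on the "classical theory of symmetrizable linear hyperbolic systems",
whose `L²` layer is the pair of identities (5.1.13)–(5.1.14) = (5.1.19)–(5.1.20) integrated in
space, the coercivity (5.1.15) = (5.1.21) of the symmetriser, and Grönwall's inequality
(5.1.22)–(5.1.23); Majda 1984, Ch. 2 §2.1, proof of Thm 2.1, the low-norm contraction step;
Friedrichs 1954 §1 for the linear symmetric systems themselves). For the LINEAR operator

  `𝓛U = A₀(t,x) ∂ₜU + ∑ⱼ Aⱼ(t,x) ∂ⱼU`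

acting on jointly smooth fields `U : S × 𝕋^d → W` (`W` a real inner-product space; time set
`S ⊆ ℝ`, one-sided time derivative `Torus.timeDerivWithin S`; coefficients jointly smooth
operator fields `A₀, Aⱼ : S × 𝕋^d → (W →L[ℝ] W)`, pointwise SYMMETRIC), this file proves:

* `partialDeriv_clm_apply`, `partialDeriv_inner_clm_apply_self` — the Leibniz rules
  `∂ᵢ(A U) = (∂ᵢA) U + A ∂ᵢU` and, for symmetric `A`, `∂ᵢ⟪A U, U⟫ = ⟪(∂ᵢA)U, U⟫ + 2⟪A ∂ᵢU, U⟫`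
  on the torus (Dafermos (5.1.14));
* `integral_inner_clm_partialDeriv` — `∫ ⟪A ∂ᵢU, U⟫ = -½ ∫ ⟪(∂ᵢA) U, U⟫` (no boundary terms on
  `𝕋^d`, `Torus.integral_partialDeriv_eq_zero`);
* `hasDerivWithinAt_symmHypEnergy` — **the energy identity**: for every jointly smooth `U`
  (no equation assumed) the energy `E(t) = ∫ ⟪A₀(t)U(t), U(t)⟫` has one-sided derivative
  `E'(t) = ∫ ⟪(∂ₜA₀ + ∑ⱼ ∂ⱼAⱼ) U, U⟫ + 2 ∫ ⟪𝓛U, U⟫` within `S` (Dafermos (5.1.13)–(5.1.14),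
  Friedrichs 1954 (1.9));
* `symmHypEnergy_le_gronwallBound` — **the `L²` energy estimate** on `[a, b]`: if
  `⟪A₀v, v⟫ ≥ c₀‖v‖²`, `⟪(∂ₜA₀ + ∑∂ⱼAⱼ)v, v⟫ ≤ K‖v‖²` and `2∫⟪𝓛U, U⟫ ≤ L ∫‖U‖² + ε` on `[a, b)`,
  then `E(t) ≤ gronwallBound E(a) ((K+L)/c₀) ε (t - a)` and `c₀ ∫‖U(t)‖² ≤ E(t)`
  (Dafermos (5.1.22)–(5.1.23));
* `symmHyp_eq_zero_of_initial` — **uniqueness**: if `‖𝓛U‖ ≤ M‖U‖` pointwise and `U(a) = 0`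
  then `U = 0` on `[a, b] × 𝕋^d`; in particular two classical solutions of a linear symmetric
  system (with a zeroth-order term) with the same data coincide, and so do two classical
  solutions of a quasilinear symmetric system once the difference of the coefficients is bounded
  by the difference of the solutions (the user supplies that Lipschitz bound).

The file is coefficient-agnostic (any jointly smooth symmetric `A₀, Aⱼ`), so it serves at once
the linearised systems `A₀(V)∂ₜU + ∑Aⱼ(V)∂ⱼU = 0` of the Picard iteration (their differences,
Dafermos (5.1.18)) and the uniqueness half of the continuation arguments. Higher-order (`H^m`)
energies, Moser-type commutator bounds and existence are NOT here.

## Mathlib / tree search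

Tree: `Torus.partialDeriv_inner`, `Torus.integral_partialDeriv_eq_zero_holds`,
`Torus.IsSmoothSpaceTimeOn.hasDerivWithinAt_integral`, `Torus.hasDerivAt_comp_add_proj_smul`
(`TorusCalculusProofs`); whole-space analogues `integral_inner_foOp_le`,
`SymmetricHyperbolicUniqueness` (`Analysis/PDE`, `A⁰ = I`, `ℝⁿ`); nothing for `A₀ ≠ I` or on
the torus (`lean search 'symmHyp|TorusSymmetric|energy_le_gronwall'`). Mathlib:
`le_gronwallBound_of_liminf_deriv_right_le`, `HasDerivWithinAt.liminf_right_slope_le`,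
`HasDerivWithinAt.clm_apply`, `HasDerivWithinAt.inner`, `Continuous.ae_eq_iff_eq`.

## References

* C. M. Dafermos, *Hyperbolic Conservation Laws in Continuum Physics*, 2nd ed., Grundlehren
  325, Springer 2005, Ch. V §5.1, proof of Thm 5.1.1: (5.1.13)–(5.1.15), (5.1.18)–(5.1.23).
  [`Dafermos2005`]
* A. Majda, *Compressible Fluid Flow and Systems of Conservation Laws in Several Space
  Variables*, Appl. Math. Sci. 53, Springer 1984, Ch. 2 §2.1, proof of Thm 2.1 (contraction in
  the low norm). [`Majda1984`]
* K. O. Friedrichs, *Symmetric hyperbolic linear differential equations*, Comm. Pure Appl.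
  Math. 7 (1954) 345–392, §1 (the energy inequality). [`Friedrichs1954`]
-/

noncomputable section

open MeasureTheory Set Filter Function
open scoped ContDiff InnerProductSpace Topology

namespace Literature.Analysis.PDE

open Literature.Analysis.FunctionSpaces Literature.Analysis.FunctionSpaces.Torus

variable {d : Type*} [Fintype d] [DecidableEq d]

/-! ## Pointwise Leibniz rules on the torus -/

section Pointwise

variable {F' G' : Type*} [NormedAddCommGroup F'] [NormedSpace ℝ F'] [NormedAddCommGroup G']
  [NormedSpace ℝ G']

omit [DecidableEq d] in
/-- The directional derivative of a `C¹` torus function is the derivative at `s = 0` of the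
function along the line `s ↦ x + s v`. [folklore] -/
theorem hasDerivAt_lineDeriv_zero {f : UnitAddTorus d → F'} (hf : IsContDiff 1 f)
    (x : UnitAddTorus d) (v : EuclideanSpace ℝ d) :
    HasDerivAt (fun s : ℝ => f (x + proj (s • v))) (lineDeriv f x v) 0 := by
  have h := hasDerivAt_comp_add_proj_smul hf x v 0
  rwa [zero_smul, proj_zero, add_zero] at h

/-- **Leibniz rule for the application of an operator field to a vector field on the torus**:
`∂ᵢ (A U)(x) = (∂ᵢA)(x) (U x) + A(x) (∂ᵢU)(x)` for `C¹` fields `A : 𝕋^d → (F' →L G')`,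
`U : 𝕋^d → F'`. [folklore] -/
theorem partialDeriv_clm_apply {A : UnitAddTorus d → (F' →L[ℝ] G')} {U : UnitAddTorus d → F'}
    (hA : IsContDiff 1 A) (hU : IsContDiff 1 U) (i : d) (x : UnitAddTorus d) :
    partialDeriv i (fun y => A y (U y)) x =
      partialDeriv i A x (U x) + A x (partialDeriv i U x) := by
  have h1 := hasDerivAt_lineDeriv_zero hA x (EuclideanSpace.single i 1)
  have h2 := hasDerivAt_lineDeriv_zero hU x (EuclideanSpace.single i 1)
  have h := h1.clm_apply h2
  simp only [zero_smul, proj_zero, add_zero] at h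
  exact h.deriv

variable {W : Type*} [NormedAddCommGroup W] [InnerProductSpace ℝ W]

/-- **Dafermos (5.1.14), pointwise**: for a `C¹` SYMMETRIC operator field `A` and a `C¹` field
`U` on the torus, `∂ᵢ ⟪A U, U⟫ = ⟪(∂ᵢA) U, U⟫ + 2 ⟪A ∂ᵢU, U⟫`.
[cite: Dafermos2005, §5.1 (5.1.14)] -/
theorem partialDeriv_inner_clm_apply_self {A : UnitAddTorus d → (W →L[ℝ] W)}
    {U : UnitAddTorus d → W} (hA : IsContDiff 1 A) (hU : IsContDiff 1 U)
    (hsym : ∀ x (v w : W), ⟪A x v, w⟫_ℝ = ⟪v, A x w⟫_ℝ) (i : d) (x : UnitAddTorus d) :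
    partialDeriv i (fun y => ⟪A y (U y), U y⟫_ℝ) x =
      ⟪partialDeriv i A x (U x), U x⟫_ℝ + 2 * ⟪A x (partialDeriv i U x), U x⟫_ℝ := by
  have hAU : IsContDiff 1 (fun y => A y (U y)) := ContDiff.clm_apply hA hU
  rw [partialDeriv_inner hAU hU, partialDeriv_clm_apply hA hU, inner_add_left, hsym x (U x),
    real_inner_comm (A x (partialDeriv i U x)) (U x)]
  ring

omit [DecidableEq d] in
/-- Smoothness of `x ↦ A x (U x)` for smooth `A`, `U` on the torus. [folklore] -/
theorem isSmooth_clm_apply {A : UnitAddTorus d → (F' →L[ℝ] G')} {U : UnitAddTorus d → F'}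
    (hA : IsSmooth A) (hU : IsSmooth U) : IsSmooth (fun y => A y (U y)) :=
  ContDiff.clm_apply hA hU

/-- **`∫ ⟪A ∂ᵢU, U⟫ = -½ ∫ ⟪(∂ᵢA) U, U⟫` on the torus** for smooth symmetric `A` and smooth `U`
(Dafermos (5.1.14) integrated over `𝕋^d`: the exact derivative `∂ᵢ⟪A U, U⟫` integrates to zero,
`Torus.integral_partialDeriv_eq_zero`). [cite: Dafermos2005, §5.1 (5.1.14)] -/
theorem integral_inner_clm_partialDeriv {A : UnitAddTorus d → (W →L[ℝ] W)}
    {U : UnitAddTorus d → W} (hA : IsSmooth A) (hU : IsSmooth U)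
    (hsym : ∀ x (v w : W), ⟪A x v, w⟫_ℝ = ⟪v, A x w⟫_ℝ) (i : d) :
    ∫ x, ⟪A x (partialDeriv i U x), U x⟫_ℝ =
      -(1 / 2) * ∫ x, ⟪partialDeriv i A x (U x), U x⟫_ℝ := by
  have hφ : IsSmooth (fun y => ⟪A y (U y), U y⟫_ℝ) := (isSmooth_clm_apply hA hU).inner hU
  have h0 : ∫ x, partialDeriv i (fun y => ⟪A y (U y), U y⟫_ℝ) x = 0 :=
    integral_partialDeriv_eq_zero_holds hφ i
  have hpt : (fun x => partialDeriv i (fun y => ⟪A y (U y), U y⟫_ℝ) x) = fun x =>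
      ⟪partialDeriv i A x (U x), U x⟫_ℝ + 2 * ⟪A x (partialDeriv i U x), U x⟫_ℝ := by
    funext x
    exact partialDeriv_inner_clm_apply_self (hA.isContDiff (by simp)) (hU.isContDiff (by simp))
      hsym i x
  rw [hpt] at h0
  have hc1 : Continuous fun x => ⟪partialDeriv i A x (U x), U x⟫_ℝ :=
    (((hA.partialDeriv i).continuous.clm_apply hU.continuous).inner hU.continuous)
  have hc2 : Continuous fun x => 2 * ⟪A x (partialDeriv i U x), U x⟫_ℝ :=
    continuous_const.mul
      ((hA.continuous.clm_apply (hU.partialDeriv i).continuous).inner hU.continuous)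
  rw [integral_add hc1.integrable_unitAddTorus hc2.integrable_unitAddTorus,
    integral_const_mul] at h0
  linarith

end Pointwise

/-! ## The energy identity -/

section Energy

variable {W : Type*} [NormedAddCommGroup W] [InnerProductSpace ℝ W]

omit [DecidableEq d] in
/-- **Differentiating the energy under the integral**: for jointly smooth `A₀` (symmetric) and
`U` on `S × 𝕋^d`, `S` convex with unique one-sided derivatives, the energy
`E(s) = ∫ ⟪A₀(s,x) U(s,x), U(s,x)⟫ dx` has one-sided derivative
`∫ (⟪∂ₜA₀ U, U⟫ + 2 ⟪A₀ ∂ₜU, U⟫)` within `S` at every `t ∈ S` (Dafermos (5.1.13) integrated;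
`Torus.IsSmoothSpaceTimeOn.hasDerivWithinAt_integral`). [cite: Dafermos2005, §5.1 (5.1.13)] -/
theorem hasDerivWithinAt_integral_inner_clm_apply_self {S : Set ℝ} (hS : Convex ℝ S)
    (hSu : UniqueDiffOn ℝ S) {A₀ : ℝ → UnitAddTorus d → (W →L[ℝ] W)}
    {U : ℝ → UnitAddTorus d → W} (hA₀ : IsSmoothSpaceTimeOn S A₀) (hU : IsSmoothSpaceTimeOn S U)
    (hsym : ∀ t ∈ S, ∀ x (v w : W), ⟪A₀ t x v, w⟫_ℝ = ⟪v, A₀ t x w⟫_ℝ) {t : ℝ} (ht : t ∈ S) :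
    HasDerivWithinAt (fun s => ∫ x, ⟪A₀ s x (U s x), U s x⟫_ℝ)
      (∫ x, (⟪timeDerivWithin S A₀ t x (U t x), U t x⟫_ℝ +
        2 * ⟪A₀ t x (timeDerivWithin S U t x), U t x⟫_ℝ)) S t := by
  set φ : ℝ → UnitAddTorus d → ℝ := fun s x => ⟪A₀ s x (U s x), U s x⟫_ℝ with hφ_def
  have hφ : IsSmoothSpaceTimeOn S φ := by
    change ContDiffOn ℝ ∞ (fun p => ⟪stLift A₀ p (stLift U p), stLift U p⟫_ℝ) (S ×ˢ univ)
    exact (hA₀.clm_apply hU).inner ℝ hU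
  have h := hφ.hasDerivWithinAt_integral hS ht
  have hpt : ∀ x, timeDerivWithin S φ t x = ⟪timeDerivWithin S A₀ t x (U t x), U t x⟫_ℝ +
      2 * ⟪A₀ t x (timeDerivWithin S U t x), U t x⟫_ℝ := by
    intro x
    have h1 := hA₀.hasDerivWithinAt_slice ht x
    have h2 := hU.hasDerivWithinAt_slice ht x
    have h3 := (h1.clm_apply h2).inner ℝ h2
    have h4 : timeDerivWithin S φ t x = ⟪A₀ t x (U t x), timeDerivWithin S U t x⟫_ℝ +
        ⟪timeDerivWithin S A₀ t x (U t x) + A₀ t x (timeDerivWithin S U t x), U t x⟫_ℝ :=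
      h3.derivWithin (hSu t ht)
    rw [h4, inner_add_left, hsym t ht x (U t x),
      real_inner_comm (A₀ t x (timeDerivWithin S U t x)) (U t x)]
    ring
  have heq : (fun x => timeDerivWithin S φ t x) = fun x =>
      ⟪timeDerivWithin S A₀ t x (U t x), U t x⟫_ℝ +
        2 * ⟪A₀ t x (timeDerivWithin S U t x), U t x⟫_ℝ := funext hpt
  rw [heq] at h
  exact h

/-- **The `L²` energy identity for linear symmetric hyperbolic operators on the torus**
(Dafermos 2005, §5.1, (5.1.13)–(5.1.14) integrated over `𝕋^d`; Friedrichs 1954, §1). Let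
`A₀, A₁, …, A_d : S × 𝕋^d → (W →L[ℝ] W)` be jointly smooth, pointwise symmetric operator fields
and `U : S × 𝕋^d → W` jointly smooth, `S` convex with unique one-sided derivatives. Then, with
`𝓛U = A₀ ∂ₜU + ∑ⱼ Aⱼ ∂ⱼU` (no equation is assumed),

  `d/dt ∫ ⟪A₀ U, U⟫ = ∫ ⟪∂ₜA₀ U, U⟫ + ∑ⱼ ∫ ⟪∂ⱼAⱼ U, U⟫ + 2 ∫ ⟪𝓛U, U⟫`

as a one-sided derivative within `S` at every `t ∈ S`. [cite: Dafermos2005, §5.1 (5.1.13)–(5.1.14)] -/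
theorem hasDerivWithinAt_symmHypEnergy {S : Set ℝ} (hS : Convex ℝ S) (hSu : UniqueDiffOn ℝ S)
    {A₀ : ℝ → UnitAddTorus d → (W →L[ℝ] W)} {A : d → ℝ → UnitAddTorus d → (W →L[ℝ] W)}
    {U : ℝ → UnitAddTorus d → W} (hA₀ : IsSmoothSpaceTimeOn S A₀)
    (hA : ∀ j, IsSmoothSpaceTimeOn S (A j)) (hU : IsSmoothSpaceTimeOn S U)
    (hsym₀ : ∀ t ∈ S, ∀ x (v w : W), ⟪A₀ t x v, w⟫_ℝ = ⟪v, A₀ t x w⟫_ℝ)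
    (hsym : ∀ j, ∀ t ∈ S, ∀ x (v w : W), ⟪A j t x v, w⟫_ℝ = ⟪v, A j t x w⟫_ℝ) {t : ℝ}
    (ht : t ∈ S) :
    HasDerivWithinAt (fun s => ∫ x, ⟪A₀ s x (U s x), U s x⟫_ℝ)
      ((∫ x, ⟪timeDerivWithin S A₀ t x (U t x), U t x⟫_ℝ) +
        (∑ j, ∫ x, ⟪partialDeriv j (A j t) x (U t x), U t x⟫_ℝ) +
        2 * ∫ x, ⟪A₀ t x (timeDerivWithin S U t x) +
          ∑ j, A j t x (partialDeriv j (U t) x), U t x⟫_ℝ) S t := by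
  have h := hasDerivWithinAt_integral_inner_clm_apply_self hS hSu hA₀ hU hsym₀ ht
  refine h.congr_deriv ?_
  -- smoothness of the slices at time `t`
  have hUt : IsSmooth (U t) := hU.isSmooth_slice ht
  have hAt : ∀ j, IsSmooth (A j t) := fun j => (hA j).isSmooth_slice ht
  have hA₀t : IsSmooth (A₀ t) := hA₀.isSmooth_slice ht
  have hdA₀ : IsSmooth (timeDerivWithin S A₀ t) := hA₀.isSmooth_timeDerivWithin hSu ht
  have hdU : IsSmooth (timeDerivWithin S U t) := hU.isSmooth_timeDerivWithin hSu ht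
  -- continuity of all integrands
  have hc0 : Continuous fun x => ⟪timeDerivWithin S A₀ t x (U t x), U t x⟫_ℝ :=
    (hdA₀.continuous.clm_apply hUt.continuous).inner hUt.continuous
  have hc1 : Continuous fun x => 2 * ⟪A₀ t x (timeDerivWithin S U t x), U t x⟫_ℝ :=
    continuous_const.mul ((hA₀t.continuous.clm_apply hdU.continuous).inner hUt.continuous)
  have hc2 : ∀ j, Continuous fun x => ⟪A j t x (partialDeriv j (U t) x), U t x⟫_ℝ := fun j =>
    ((hAt j).continuous.clm_apply (hUt.partialDeriv j).continuous).inner hUt.continuous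
  have hc3 : Continuous fun x => ⟪A₀ t x (timeDerivWithin S U t x), U t x⟫_ℝ :=
    (hA₀t.continuous.clm_apply hdU.continuous).inner hUt.continuous
  have hc4 : Continuous fun x => ∑ j, ⟪A j t x (partialDeriv j (U t) x), U t x⟫_ℝ :=
    continuous_finsetSum _ fun j _ => hc2 j
  -- the symmetric terms: `∫ ⟪Aⱼ ∂ⱼU, U⟫ = -½ ∫ ⟪∂ⱼAⱼ U, U⟫`
  have hj : ∀ j, ∫ x, ⟪A j t x (partialDeriv j (U t) x), U t x⟫_ℝ =
      -(1 / 2) * ∫ x, ⟪partialDeriv j (A j t) x (U t x), U t x⟫_ℝ := fun j =>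
    integral_inner_clm_partialDeriv (hAt j) hUt (hsym j t ht) j
  -- expand the pairing with `𝓛U`
  have hsplit : ∫ x, ⟪A₀ t x (timeDerivWithin S U t x) +
        ∑ j, A j t x (partialDeriv j (U t) x), U t x⟫_ℝ =
      (∫ x, ⟪A₀ t x (timeDerivWithin S U t x), U t x⟫_ℝ) +
        ∑ j, ∫ x, ⟪A j t x (partialDeriv j (U t) x), U t x⟫_ℝ := by
    have hpt : (fun x => ⟪A₀ t x (timeDerivWithin S U t x) +
        ∑ j, A j t x (partialDeriv j (U t) x), U t x⟫_ℝ) = fun x =>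
        ⟪A₀ t x (timeDerivWithin S U t x), U t x⟫_ℝ +
          ∑ j, ⟪A j t x (partialDeriv j (U t) x), U t x⟫_ℝ := by
      funext x
      rw [inner_add_left, sum_inner]
    rw [hpt, integral_add hc3.integrable_unitAddTorus hc4.integrable_unitAddTorus,
      integral_finsetSum _ fun j _ => (hc2 j).integrable_unitAddTorus]
  rw [integral_add hc0.integrable_unitAddTorus hc1.integrable_unitAddTorus, integral_const_mul,
    hsplit]
  simp_rw [hj]
  have hzero : ∑ j, 2 * (-(1 / 2) * ∫ x, ⟪partialDeriv j (A j t) x (U t x), U t x⟫_ℝ) =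
      -∑ j, ∫ x, ⟪partialDeriv j (A j t) x (U t x), U t x⟫_ℝ := by
    rw [← Finset.sum_neg_distrib]
    exact Finset.sum_congr rfl fun j _ => by ring
  rw [mul_add, Finset.mul_sum, hzero]
  ring

end Energy

/-! ## The `L²` energy estimate and uniqueness -/

section Estimate

variable {W : Type*} [NormedAddCommGroup W] [InnerProductSpace ℝ W]

omit [DecidableEq d] in
/-- The energy dominates `c₀` times the `L²` norm when the symmetriser is coercive,
`⟪A₀ v, v⟫ ≥ c₀ ‖v‖²` (Dafermos (5.1.15) = (5.1.21)). [cite: Dafermos2005, §5.1 (5.1.15)] -/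
theorem mul_integral_norm_sq_le_symmHypEnergy {A₀ : UnitAddTorus d → (W →L[ℝ] W)}
    {U : UnitAddTorus d → W} (hA₀ : IsSmooth A₀) (hU : IsSmooth U) {c₀ : ℝ}
    (hcoer : ∀ x (v : W), c₀ * ‖v‖ ^ 2 ≤ ⟪A₀ x v, v⟫_ℝ) :
    c₀ * ∫ x, ‖U x‖ ^ 2 ≤ ∫ x, ⟪A₀ x (U x), U x⟫_ℝ := by
  rw [← integral_const_mul]
  refine integral_mono ?_ ?_ fun x => hcoer x (U x)
  · exact (continuous_const.mul (hU.continuous.norm.pow 2)).integrable_unitAddTorus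
  · exact ((hA₀.continuous.clm_apply hU.continuous).inner hU.continuous).integrable_unitAddTorus

omit [DecidableEq d] in
/-- A pointwise quadratic-form bound `⟪B v, v⟫ ≤ K ‖v‖²` integrates to
`∫ ⟪B U, U⟫ ≤ K ∫ ‖U‖²` for continuous fields on the torus. [folklore] -/
theorem integral_inner_clm_apply_self_le {B : UnitAddTorus d → (W →L[ℝ] W)}
    {U : UnitAddTorus d → W} (hB : Continuous B) (hU : Continuous U) {K : ℝ}
    (hK : ∀ x (v : W), ⟪B x v, v⟫_ℝ ≤ K * ‖v‖ ^ 2) :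
    ∫ x, ⟪B x (U x), U x⟫_ℝ ≤ K * ∫ x, ‖U x‖ ^ 2 := by
  rw [← integral_const_mul]
  refine integral_mono ?_ ?_ fun x => hK x (U x)
  · exact ((hB.clm_apply hU).inner hU).integrable_unitAddTorus
  · exact (continuous_const.mul (hU.norm.pow 2)).integrable_unitAddTorus

/-- **The `L²` energy estimate for linear symmetric hyperbolic operators on the torus**
(Dafermos 2005, §5.1, (5.1.13)–(5.1.15) with Grönwall's inequality, as in (5.1.22)–(5.1.23);
Majda 1984, proof of Thm 2.1, the low-norm estimate). On a time slab `[a, b] × 𝕋^d` let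
`A₀, Aⱼ` be jointly smooth symmetric operator fields and `U` a jointly smooth field, and assume,
for constants `c₀ > 0`, `K, L ≥ 0`, `ε`:
coercivity `⟪A₀ v, v⟫ ≥ c₀‖v‖²`; the bulk bound `⟪(∂ₜA₀ + ∑ⱼ∂ⱼAⱼ) v, v⟫ ≤ K‖v‖²`; and the
residual bound `2 ∫ ⟪𝓛U(t), U(t)⟫ ≤ L ∫ ‖U(t)‖² + ε` for `t ∈ [a, b)`, `𝓛U = A₀∂ₜU + ∑Aⱼ∂ⱼU`.
Then the energy `E(t) = ∫ ⟪A₀(t) U(t), U(t)⟫` satisfies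
`E(t) ≤ gronwallBound E(a) ((K + L)/c₀) ε (t - a)` on `[a, b]`
(`= e^{(K+L)(t-a)/c₀} E(a) + ε ∫₀^{t-a} e^{(K+L)s/c₀} ds`). [cite: Dafermos2005, §5.1 (5.1.22)–(5.1.23)] -/
theorem symmHypEnergy_le_gronwallBound {a b : ℝ} (hab : a < b)
    {A₀ : ℝ → UnitAddTorus d → (W →L[ℝ] W)} {A : d → ℝ → UnitAddTorus d → (W →L[ℝ] W)}
    {U : ℝ → UnitAddTorus d → W} (hA₀ : IsSmoothSpaceTimeOn (Icc a b) A₀)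
    (hA : ∀ j, IsSmoothSpaceTimeOn (Icc a b) (A j)) (hU : IsSmoothSpaceTimeOn (Icc a b) U)
    (hsym₀ : ∀ t ∈ Icc a b, ∀ x (v w : W), ⟪A₀ t x v, w⟫_ℝ = ⟪v, A₀ t x w⟫_ℝ)
    (hsym : ∀ j, ∀ t ∈ Icc a b, ∀ x (v w : W), ⟪A j t x v, w⟫_ℝ = ⟪v, A j t x w⟫_ℝ)
    {c₀ K L ε : ℝ} (hc₀ : 0 < c₀) (hK : 0 ≤ K) (hL : 0 ≤ L)
    (hcoer : ∀ t ∈ Icc a b, ∀ x (v : W), c₀ * ‖v‖ ^ 2 ≤ ⟪A₀ t x v, v⟫_ℝ)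
    (hbulk : ∀ t ∈ Ico a b, ∀ x (v : W),
      ⟪(timeDerivWithin (Icc a b) A₀ t x + ∑ j, partialDeriv j (A j t) x) v, v⟫_ℝ ≤
        K * ‖v‖ ^ 2)
    (hres : ∀ t ∈ Ico a b,
      2 * ∫ x, ⟪A₀ t x (timeDerivWithin (Icc a b) U t x) +
          ∑ j, A j t x (partialDeriv j (U t) x), U t x⟫_ℝ ≤
        L * (∫ x, ‖U t x‖ ^ 2) + ε) :
    ∀ t ∈ Icc a b, ∫ x, ⟪A₀ t x (U t x), U t x⟫_ℝ ≤
      gronwallBound (∫ x, ⟪A₀ a x (U a x), U a x⟫_ℝ) ((K + L) / c₀) ε (t - a) := by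
  set E : ℝ → ℝ := fun s => ∫ x, ⟪A₀ s x (U s x), U s x⟫_ℝ with hE_def
  have hS : Convex ℝ (Icc a b) := convex_Icc a b
  have hSu : UniqueDiffOn ℝ (Icc a b) := uniqueDiffOn_Icc hab
  -- the derivative of the energy within `[a, b]`
  set E' : ℝ → ℝ := fun t => (∫ x, ⟪timeDerivWithin (Icc a b) A₀ t x (U t x), U t x⟫_ℝ) +
      (∑ j, ∫ x, ⟪partialDeriv j (A j t) x (U t x), U t x⟫_ℝ) +
      2 * ∫ x, ⟪A₀ t x (timeDerivWithin (Icc a b) U t x) +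
        ∑ j, A j t x (partialDeriv j (U t) x), U t x⟫_ℝ with hE'_def
  have hderiv : ∀ t ∈ Icc a b, HasDerivWithinAt E (E' t) (Icc a b) t := fun t ht =>
    hasDerivWithinAt_symmHypEnergy hS hSu hA₀ hA hU hsym₀ hsym ht
  have hcont : ContinuousOn E (Icc a b) := fun t ht => (hderiv t ht).continuousWithinAt
  -- right derivatives in the interior-or-left points
  have hderiv' : ∀ t ∈ Ico a b, HasDerivWithinAt E (E' t) (Ici t) t := by
    intro t ht
    refine (hderiv t (Ico_subset_Icc_self ht)).mono_of_mem_nhdsWithin ?_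
    exact mem_of_superset (Icc_mem_nhdsGE ht.2) (Icc_subset_Icc ht.1 le_rfl)
  -- the differential inequality `E' ≤ ((K + L)/c₀) E + ε`
  have hbound : ∀ t ∈ Ico a b, E' t ≤ (K + L) / c₀ * E t + ε := by
    intro t ht
    have ht' : t ∈ Icc a b := Ico_subset_Icc_self ht
    have hUt : IsSmooth (U t) := hU.isSmooth_slice ht'
    have hAt : ∀ j, IsSmooth (A j t) := fun j => (hA j).isSmooth_slice ht'
    have hA₀t : IsSmooth (A₀ t) := hA₀.isSmooth_slice ht'
    have hdA₀ : IsSmooth (timeDerivWithin (Icc a b) A₀ t) := hA₀.isSmooth_timeDerivWithin hSu ht'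
    -- `c₀ ∫‖U‖² ≤ E`
    have hcoerE : c₀ * ∫ x, ‖U t x‖ ^ 2 ≤ E t :=
      mul_integral_norm_sq_le_symmHypEnergy hA₀t hUt (hcoer t ht')
    -- the bulk term
    have hB : Continuous fun x => timeDerivWithin (Icc a b) A₀ t x + ∑ j, partialDeriv j (A j t) x :=
      hdA₀.continuous.add (continuous_finsetSum _ fun j _ => ((hAt j).partialDeriv j).continuous)
    have hbulkI : ∫ x, ⟪(timeDerivWithin (Icc a b) A₀ t x + ∑ j, partialDeriv j (A j t) x) (U t x),
        U t x⟫_ℝ ≤ K * ∫ x, ‖U t x‖ ^ 2 :=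
      integral_inner_clm_apply_self_le hB hUt.continuous (hbulk t ht)
    -- split the bulk integral into its `1 + d` pieces
    have hc0 : Continuous fun x => ⟪timeDerivWithin (Icc a b) A₀ t x (U t x), U t x⟫_ℝ :=
      (hdA₀.continuous.clm_apply hUt.continuous).inner hUt.continuous
    have hc2 : ∀ j, Continuous fun x => ⟪partialDeriv j (A j t) x (U t x), U t x⟫_ℝ := fun j =>
      (((hAt j).partialDeriv j).continuous.clm_apply hUt.continuous).inner hUt.continuous
    have hbulk_split : ∫ x, ⟪(timeDerivWithin (Icc a b) A₀ t x + ∑ j, partialDeriv j (A j t) x)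
        (U t x), U t x⟫_ℝ = (∫ x, ⟪timeDerivWithin (Icc a b) A₀ t x (U t x), U t x⟫_ℝ) +
          ∑ j, ∫ x, ⟪partialDeriv j (A j t) x (U t x), U t x⟫_ℝ := by
      have hpt : (fun x => ⟪(timeDerivWithin (Icc a b) A₀ t x + ∑ j, partialDeriv j (A j t) x)
          (U t x), U t x⟫_ℝ) = fun x => ⟪timeDerivWithin (Icc a b) A₀ t x (U t x), U t x⟫_ℝ +
            ∑ j, ⟪partialDeriv j (A j t) x (U t x), U t x⟫_ℝ := by
        funext x
        rw [add_apply, sum_apply, inner_add_left, sum_inner]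
      rw [hpt, integral_add hc0.integrable_unitAddTorus
        (continuous_finsetSum _ fun j _ => hc2 j).integrable_unitAddTorus,
        integral_finsetSum _ fun j _ => (hc2 j).integrable_unitAddTorus]
    have h1 : (∫ x, ⟪timeDerivWithin (Icc a b) A₀ t x (U t x), U t x⟫_ℝ) +
        ∑ j, ∫ x, ⟪partialDeriv j (A j t) x (U t x), U t x⟫_ℝ ≤ K * ∫ x, ‖U t x‖ ^ 2 := by
      rw [← hbulk_split]; exact hbulkI
    have h2 := hres t ht
    have h3 : K * (∫ x, ‖U t x‖ ^ 2) + L * (∫ x, ‖U t x‖ ^ 2) ≤ (K + L) / c₀ * E t := by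
      rw [← add_mul, div_mul_eq_mul_div, le_div_iff₀ hc₀]
      calc (K + L) * (∫ x, ‖U t x‖ ^ 2) * c₀ = (K + L) * (c₀ * ∫ x, ‖U t x‖ ^ 2) := by ring
        _ ≤ (K + L) * E t := mul_le_mul_of_nonneg_left hcoerE (add_nonneg hK hL)
    show E' t ≤ (K + L) / c₀ * E t + ε
    simp only [hE'_def]
    linarith
  intro t ht
  exact le_gronwallBound_of_liminf_deriv_right_le hcont
    (fun s hs r hr => (hderiv' s hs).liminf_right_slope_le hr) le_rfl hbound t ht

/-- **Uniqueness for linear symmetric hyperbolic systems on the torus** (Dafermos 2005, §5.1,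
(5.1.18)–(5.1.23) with `V = V̄`; Friedrichs 1954, §1). On `[a, b] × 𝕋^d`, with jointly smooth
symmetric `A₀` (coercive: `⟪A₀v, v⟫ ≥ c₀‖v‖²`, `c₀ > 0`) and `Aⱼ`, let the jointly smooth field
`U` satisfy the pointwise residual bound `‖A₀∂ₜU + ∑ⱼAⱼ∂ⱼU‖ ≤ M ‖U‖` (e.g. `U` solves
`A₀∂ₜU + ∑Aⱼ∂ⱼU + B U = 0` with bounded `B`, or `U` is the difference of two solutions of a
quasilinear symmetric system with Lipschitz coefficients) and vanish at `t = a`. Then `U = 0` on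
`[a, b] × 𝕋^d`. [cite: Dafermos2005, §5.1 (5.1.18)–(5.1.23)] -/
theorem symmHyp_eq_zero_of_initial {a b : ℝ} (hab : a < b)
    {A₀ : ℝ → UnitAddTorus d → (W →L[ℝ] W)} {A : d → ℝ → UnitAddTorus d → (W →L[ℝ] W)}
    {U : ℝ → UnitAddTorus d → W} (hA₀ : IsSmoothSpaceTimeOn (Icc a b) A₀)
    (hA : ∀ j, IsSmoothSpaceTimeOn (Icc a b) (A j)) (hU : IsSmoothSpaceTimeOn (Icc a b) U)
    (hsym₀ : ∀ t ∈ Icc a b, ∀ x (v w : W), ⟪A₀ t x v, w⟫_ℝ = ⟪v, A₀ t x w⟫_ℝ)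
    (hsym : ∀ j, ∀ t ∈ Icc a b, ∀ x (v w : W), ⟪A j t x v, w⟫_ℝ = ⟪v, A j t x w⟫_ℝ)
    {c₀ M : ℝ} (hc₀ : 0 < c₀) (hM : 0 ≤ M)
    (hcoer : ∀ t ∈ Icc a b, ∀ x (v : W), c₀ * ‖v‖ ^ 2 ≤ ⟪A₀ t x v, v⟫_ℝ)
    (hres : ∀ t ∈ Ico a b, ∀ x,
      ‖A₀ t x (timeDerivWithin (Icc a b) U t x) + ∑ j, A j t x (partialDeriv j (U t) x)‖ ≤
        M * ‖U t x‖)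
    (h0 : ∀ x, U a x = 0) : ∀ t ∈ Icc a b, ∀ x, U t x = 0 := by
  have hSu : UniqueDiffOn ℝ (Icc a b) := uniqueDiffOn_Icc hab
  -- a bound `K` for the bulk quadratic form on the compact slab
  obtain ⟨K, hK0, hK⟩ : ∃ K, 0 ≤ K ∧ ∀ t ∈ Ico a b, ∀ x (v : W),
      ⟪(timeDerivWithin (Icc a b) A₀ t x + ∑ j, partialDeriv j (A j t) x) v, v⟫_ℝ ≤
        K * ‖v‖ ^ 2 := by
    -- continuity of the bulk operator field on the compact set `[a, b] × 𝕋^d`, via the lift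
    set Bf : ℝ × EuclideanSpace ℝ d → (W →L[ℝ] W) := fun p =>
      fderivWithin ℝ (stLift A₀) (Icc a b ×ˢ univ) p (1, 0) +
        ∑ j, fderivWithin ℝ (stLift (A j)) (Icc a b ×ˢ univ) p (0, EuclideanSpace.single j 1)
      with hBf_def
    have hU' : UniqueDiffOn ℝ (Icc a b ×ˢ (univ : Set (EuclideanSpace ℝ d))) :=
      hSu.prod uniqueDiffOn_univ
    have hBc : ContinuousOn Bf (Icc a b ×ˢ univ) := by
      refine ContinuousOn.add ?_ (continuousOn_finsetSum _ fun j _ => ?_)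
      · exact (hA₀.continuousOn_fderivWithin hU' (by simp)).clm_apply continuousOn_const
      · exact ((hA j).continuousOn_fderivWithin hU' (by simp)).clm_apply continuousOn_const
    obtain ⟨K, hK⟩ := (isCompact_Icc.prod isCompact_toLp_image_pi_Icc).exists_bound_of_continuousOn
      (hBc.mono (prod_mono le_rfl (subset_univ _)))
    refine ⟨max K 0, le_max_right _ _, fun t ht x v => ?_⟩
    have ht' : t ∈ Icc a b := Ico_subset_Icc_self ht
    -- identify the bulk operator at `(t, x)` with `Bf (t, repr x)`
    have hrepr : timeDerivWithin (Icc a b) A₀ t x + ∑ j, partialDeriv j (A j t) x =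
        Bf (t, repr x) := by
      have h1 : timeDerivWithin (Icc a b) A₀ t x =
          fderivWithin ℝ (stLift A₀) (Icc a b ×ˢ univ) (t, repr x) (1, 0) := by
        conv_lhs => rw [← proj_repr x]
        exact hA₀.timeDerivWithin_apply_proj hSu ht' (repr x)
      have h2 : ∀ j, partialDeriv j (A j t) x =
          fderivWithin ℝ (stLift (A j)) (Icc a b ×ˢ univ) (t, repr x)
            (0, EuclideanSpace.single j 1) := by
        intro j
        have hs : IsSmooth (A j t) := (hA j).isSmooth_slice ht'
        rw [partialDeriv_eq_fderiv_apply (hs.isContDiff (by simp)) j]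
        conv_lhs => rw [← proj_repr x]
        rw [← fderiv_lift]
        -- the space derivative of the lift is the space–time derivative in direction `(0, e)`
        have hd : HasFDerivWithinAt (stLift (A j))
            (fderivWithin ℝ (stLift (A j)) (Icc a b ×ˢ univ) (t, repr x)) (Icc a b ×ˢ univ)
            (t, repr x) :=
          ((hA j).differentiableOn (by simp) (t, repr x)
            (mk_mem_prod ht' (mem_univ _))).hasFDerivWithinAt
        have hc : HasFDerivWithinAt
            (fun y : EuclideanSpace ℝ d => ((t, y) : ℝ × EuclideanSpace ℝ d))
            (ContinuousLinearMap.inr ℝ ℝ (EuclideanSpace ℝ d)) univ (repr x) :=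
          ((hasFDerivAt_const t (repr x)).prodMk (hasFDerivAt_id (repr x))).hasFDerivWithinAt
        have hcomp := (hd.comp (repr x) hc (fun y _ => mk_mem_prod ht' (mem_univ y))).hasFDerivAt
          univ_mem
        have hlift : lift (A j t) = stLift (A j) ∘ fun y => (t, y) := rfl
        rw [hlift, hcomp.fderiv]
        simp
      show _ = fderivWithin ℝ (stLift A₀) (Icc a b ×ˢ univ) (t, repr x) (1, 0) +
        ∑ j, fderivWithin ℝ (stLift (A j)) (Icc a b ×ˢ univ) (t, repr x)
          (0, EuclideanSpace.single j 1)
      rw [h1]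
      congr 1
      exact Finset.sum_congr rfl fun j _ => h2 j
    have hnorm : ‖Bf (t, repr x)‖ ≤ K :=
      hK (t, repr x) (mk_mem_prod ht' (repr_mem_toLp_image_pi_Icc x))
    rw [hrepr]
    calc ⟪Bf (t, repr x) v, v⟫_ℝ ≤ ‖Bf (t, repr x) v‖ * ‖v‖ := real_inner_le_norm _ _
      _ ≤ K * ‖v‖ * ‖v‖ := by
        gcongr
        exact (Bf (t, repr x)).le_of_opNorm_le hnorm v
      _ = K * ‖v‖ ^ 2 := by ring
      _ ≤ max K 0 * ‖v‖ ^ 2 := by gcongr; exact le_max_left _ _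
  -- the residual bound in integrated form
  have hres' : ∀ t ∈ Ico a b,
      2 * ∫ x, ⟪A₀ t x (timeDerivWithin (Icc a b) U t x) +
          ∑ j, A j t x (partialDeriv j (U t) x), U t x⟫_ℝ ≤
        2 * M * (∫ x, ‖U t x‖ ^ 2) + 0 := by
    intro t ht
    have ht' : t ∈ Icc a b := Ico_subset_Icc_self ht
    have hUt : IsSmooth (U t) := hU.isSmooth_slice ht'
    have hA₀t : IsSmooth (A₀ t) := hA₀.isSmooth_slice ht'
    have hAt : ∀ j, IsSmooth (A j t) := fun j => (hA j).isSmooth_slice ht'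
    have hdU : IsSmooth (timeDerivWithin (Icc a b) U t) := hU.isSmooth_timeDerivWithin hSu ht'
    have hLc : Continuous fun x => A₀ t x (timeDerivWithin (Icc a b) U t x) +
        ∑ j, A j t x (partialDeriv j (U t) x) :=
      (hA₀t.continuous.clm_apply hdU.continuous).add
        (continuous_finsetSum _ fun j _ =>
          (hAt j).continuous.clm_apply (hUt.partialDeriv j).continuous)
    have hmono : ∫ x, ⟪A₀ t x (timeDerivWithin (Icc a b) U t x) +
          ∑ j, A j t x (partialDeriv j (U t) x), U t x⟫_ℝ ≤ ∫ x, M * ‖U t x‖ ^ 2 := by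
      refine integral_mono (hLc.inner hUt.continuous).integrable_unitAddTorus
        (continuous_const.mul (hUt.continuous.norm.pow 2)).integrable_unitAddTorus fun x => ?_
      have h1 := hres t ht x
      have h2 := real_inner_le_norm (A₀ t x (timeDerivWithin (Icc a b) U t x) +
          ∑ j, A j t x (partialDeriv j (U t) x)) (U t x)
      show ⟪A₀ t x (timeDerivWithin (Icc a b) U t x) +
          ∑ j, A j t x (partialDeriv j (U t) x), U t x⟫_ℝ ≤ M * ‖U t x‖ ^ 2
      nlinarith [norm_nonneg (U t x)]
    rw [integral_const_mul] at hmono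
    linarith
  have hE0 : ∫ x, ⟪A₀ a x (U a x), U a x⟫_ℝ = 0 := by
    simp [h0]
  have hgr := symmHypEnergy_le_gronwallBound hab hA₀ hA hU hsym₀ hsym hc₀ hK0
    (by positivity : (0 : ℝ) ≤ 2 * M) hcoer hK hres'
  intro t ht x
  have ht_le := hgr t ht
  rw [hE0, gronwallBound_ε0_δ0] at ht_le
  have hUt : IsSmooth (U t) := hU.isSmooth_slice ht
  have hA₀t : IsSmooth (A₀ t) := hA₀.isSmooth_slice ht
  have hcoerE : c₀ * ∫ x, ‖U t x‖ ^ 2 ≤ ∫ x, ⟪A₀ t x (U t x), U t x⟫_ℝ :=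
    mul_integral_norm_sq_le_symmHypEnergy hA₀t hUt (hcoer t ht)
  have hint0 : ∫ x, ‖U t x‖ ^ 2 = 0 := by
    have hnn : 0 ≤ ∫ x, ‖U t x‖ ^ 2 := integral_nonneg fun x => sq_nonneg _
    nlinarith
  have hcont : Continuous fun x => ‖U t x‖ ^ 2 := hUt.continuous.norm.pow 2
  have hae : (fun x => ‖U t x‖ ^ 2) =ᵐ[volume] 0 :=
    (integral_eq_zero_iff_of_nonneg (fun x => sq_nonneg _) hcont.integrable_unitAddTorus).1 hint0
  have heq : (fun x => ‖U t x‖ ^ 2) = 0 := (hcont.ae_eq_iff_eq volume continuous_const).1 hae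
  have := congr_fun heq x
  simpa using this

end Estimate

end Literature.Analysis.PDE

end
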